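import Summits.AtomisticToContinuum.Crystallization.Theorems.ExcessDecayLiouvilleComparison
import Summits.AtomisticToContinuum.Crystallization.Theorems.ExcessDecayLiouvilleLongRange
import Summits.AtomisticToContinuum.Crystallization.Theorems.ExcessDecayLiouvilleLevelMasses

/-!
# Route `ExcessDecayLiouville`: the comparison inequality made quantitative (nonlinear half, IV)

Harmonic-replacement architecture for item `ExcessDecay` (stmt-AtomisticToContinuum-9334), nonlinear half.
From `comparison_energy_abs` (rows of the correction `w` = forcing `f` + antisymmetric flux `Φ` with
`‖Φ p q‖ ≤ Λ |p−q|⁻⁸ ‖vt p − vt q‖`), Cauchy–Schwarz, the localised long-range difference estimate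
`longRange_local_le` and the Poincaré inequality give the bound of `nnForm w` by the `ℓ²(FW)` norm of the
forcing and the near-neighbour form of `vt` on a larger ball:

* `NN_le_nnForm` : finite near-neighbour sums are bounded by `nnForm`;
* `sum_norm_le_sqrt_card_mul` : `Σ_{FW} ‖w‖ ≤ (32ρ'³)^{1/2} ‖w‖_{ℓ²}`;
* `flux_pairing_le` : `ΣΣ |p−q|⁻⁸ ‖Dvt‖ ‖Dw‖ ≤ 2·(4·10⁶)·NN[vt]^{1/2} nnForm(w)^{1/2} + far junk`;
(the solving step `nnForm_correction_le` is in `ExcessDecayLiouvilleComparisonEnergy`).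

All `[folklore]`; helper lemmas, nothing here closes an item.
-/

noncomputable section

namespace Summit.AtomisticToContinuum.Crystallization.Theorems.ExcessDecayLiouville

open scoped BigOperators Topology InnerProductSpace RealInnerProductSpace Classical
open Literature.MathematicalPhysics.StatisticalMechanics
open Summit.AtomisticToContinuum.Crystallization.Theorems.PhononStabilityNegative

-- Local notation: the force-constant map `K(e)w = h(|e|²)w + 2⟪e,w⟫h′(|e|²)e`.
local notation3 "𝕂[" e "] " w:max =>
  (-((‖e‖ ^ 2)⁻¹) ^ 7 + ((‖e‖ ^ 2)⁻¹) ^ 4) • w + (2 * ⟪e, w⟫ * (7 * ((‖e‖ ^ 2)⁻¹) ^ 8 - 4 * ((‖e‖ ^ 2)⁻¹) ^ 5)) • e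

section

variable {t : Fin 2 → (EuclideanSpace ℝ (Fin 3))} {A : (EuclideanSpace ℝ (Fin 3)) →L[ℝ] (EuclideanSpace ℝ (Fin 3))}
  {κ : ℝ}

variable (hA : Adm₀ A) (hI : Inner₀ t A)

set_option quotPrecheck false in
-- Local notation: the operator row `(L v)(p)`.
local notation "𝕃" v:max " @ " p:max =>
  tsum (fun q : Sites₀ t A => (if ((p : Sites₀ t A) : EuclideanSpace ℝ (Fin 3)) ≠ q then
    𝕂[((p : Sites₀ t A) : EuclideanSpace ℝ (Fin 3)) - q] (v ((p : Sites₀ t A) : EuclideanSpace ℝ (Fin 3)) - v q) else 0))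
set_option quotPrecheck false in
-- Local notation: the finite near-neighbour form on the ball of radius `X` about `c`.
local notation "NN[" v ", " c ", " X "]" =>
  (∑ p ∈ (finite_sites_dist_le (t := t) (A := A) hA hI c X).toFinset,
    ∑ q ∈ (finite_sites_dist_le (t := t) (A := A) hA hI c X).toFinset,
      (if p ≠ q ∧ dist p q ≤ 11 / 10 then ‖v p - v q‖ ^ 2 else (0 : ℝ)))

/-! ## Finite near-neighbour sums versus `nnForm` -/

/-- **Finite near-neighbour sums are bounded by `nnForm`** (for finitely supported fields). [folklore] -/
theorem NN_le_nnForm {v : (EuclideanSpace ℝ (Fin 3)) → (EuclideanSpace ℝ (Fin 3))} (hv : (Function.support v).Finite)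
    (c : EuclideanSpace ℝ (Fin 3)) (X : ℝ) : NN[v, c, X] ≤ nnForm t A v := by
  classical
  set F := (finite_sites_dist_le (t := t) (A := A) hA hI c X).toFinset with hF
  have hmem : ∀ x ∈ F, x ∈ Sites₀ t A := fun x hx => ((Set.Finite.mem_toFinset _).1 hx).1
  set G : Finset (Sites₀ t A) := F.subtype (· ∈ Sites₀ t A) with hG
  -- rewrite as sums over sites
  have h1 : NN[v, c, X] = ∑ p ∈ G, ∑ q ∈ G,
      (if (p : EuclideanSpace ℝ (Fin 3)) ≠ q ∧ dist (p : EuclideanSpace ℝ (Fin 3)) q ≤ 11 / 10 then ‖v p - v q‖ ^ 2 else (0 : ℝ)) := by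
    rw [hG, Finset.sum_subtype_of_mem (f := fun x => ∑ q ∈ F.subtype (· ∈ Sites₀ t A),
      (if x ≠ (q : EuclideanSpace ℝ (Fin 3)) ∧ dist x q ≤ 11 / 10 then ‖v x - v q‖ ^ 2 else (0 : ℝ))) hmem]
    refine Finset.sum_congr rfl fun x _ => ?_
    rw [Finset.sum_subtype_of_mem (f := fun y => if x ≠ y ∧ dist x y ≤ 11 / 10 then ‖v x - v y‖ ^ 2 else (0 : ℝ)) hmem]
  rw [h1]
  unfold nnForm
  have hrows := summable_nnRows hA hI hv
  calc ∑ p ∈ G, ∑ q ∈ G, (if (p : EuclideanSpace ℝ (Fin 3)) ≠ q ∧ dist (p : EuclideanSpace ℝ (Fin 3)) q ≤ 11 / 10 then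
        ‖v p - v q‖ ^ 2 else (0 : ℝ))
      ≤ ∑ p ∈ G, ∑' q : Sites₀ t A, (if dist (p : EuclideanSpace ℝ (Fin 3)) q ≤ 11 / 10 then ‖v p - v q‖ ^ 2 else 0) := by
        refine Finset.sum_le_sum fun p _ => ?_
        refine le_trans (Finset.sum_le_sum fun q _ => ?_) ((summable_nnRow hA hI v p).sum_le_tsum G fun q _ => by positivity)
        by_cases h : (p : EuclideanSpace ℝ (Fin 3)) ≠ q ∧ dist (p : EuclideanSpace ℝ (Fin 3)) q ≤ 11 / 10
        · rw [if_pos h, if_pos h.2]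
        · rw [if_neg h]; positivity
    _ ≤ ∑' p : Sites₀ t A, ∑' q : Sites₀ t A, (if dist (p : EuclideanSpace ℝ (Fin 3)) q ≤ 11 / 10 then ‖v p - v q‖ ^ 2 else 0) :=
        hrows.sum_le_tsum G fun p _ => tsum_nonneg fun q => by positivity

/-! ## Small tools -/

/-- `Σ_{x∈F} ‖w x‖ ≤ (card F)^{1/2} (Σ_{x ∈ F} ‖w x‖²)^{1/2}` (Cauchy–Schwarz). [folklore] -/
theorem sum_norm_le_sqrt_card_mul {F : Finset (EuclideanSpace ℝ (Fin 3))} {w : (EuclideanSpace ℝ (Fin 3)) → (EuclideanSpace ℝ (Fin 3))} :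
    ∑ x ∈ F, ‖w x‖ ≤ Real.sqrt F.card * Real.sqrt (∑ x ∈ F, ‖w x‖ ^ 2) := by
  have h := Finset.sum_mul_sq_le_sq_mul_sq F (fun _ => (1 : ℝ)) (fun x => ‖w x‖)
  simp only [one_pow, Finset.sum_const, nsmul_eq_mul, mul_one, one_mul] at h
  have h0 : 0 ≤ ∑ x ∈ F, ‖w x‖ := Finset.sum_nonneg fun _ _ => norm_nonneg _
  rw [← Real.sqrt_mul (Nat.cast_nonneg _), ← Real.sqrt_sq h0]
  exact Real.sqrt_le_sqrt h

/-- Cauchy–Schwarz for a double sum with a common weight: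
`ΣΣ ω ‖a‖ ‖b‖ ≤ (ΣΣ ω ‖a‖²)^{1/2} (ΣΣ ω ‖b‖²)^{1/2}` (`ω ≥ 0`). [folklore] -/
theorem sum_sum_weight_mul_le {γ : Type*} (T : Finset γ) (U : γ → Finset γ) {ω a b : γ → γ → ℝ}
    (hω : ∀ p q, 0 ≤ ω p q) (ha : ∀ p q, 0 ≤ a p q) (hb : ∀ p q, 0 ≤ b p q) :
    ∑ p ∈ T, ∑ q ∈ U p, ω p q * a p q * b p q ≤
      Real.sqrt (∑ p ∈ T, ∑ q ∈ U p, ω p q * a p q ^ 2) * Real.sqrt (∑ p ∈ T, ∑ q ∈ U p, ω p q * b p q ^ 2) := by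
  classical
  have h := Finset.sum_mul_sq_le_sq_mul_sq (T.sigma U) (fun x => Real.sqrt (ω x.1 x.2) * a x.1 x.2)
    (fun x => Real.sqrt (ω x.1 x.2) * b x.1 x.2)
  have e1 : ∀ x : Σ _ : γ, γ, Real.sqrt (ω x.1 x.2) * a x.1 x.2 * (Real.sqrt (ω x.1 x.2) * b x.1 x.2) =
      ω x.1 x.2 * a x.1 x.2 * b x.1 x.2 := fun x => by
    have h := Real.mul_self_sqrt (hω x.1 x.2)
    calc Real.sqrt (ω x.1 x.2) * a x.1 x.2 * (Real.sqrt (ω x.1 x.2) * b x.1 x.2)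
        = (Real.sqrt (ω x.1 x.2) * Real.sqrt (ω x.1 x.2)) * a x.1 x.2 * b x.1 x.2 := by ring
      _ = ω x.1 x.2 * a x.1 x.2 * b x.1 x.2 := by rw [h]
  have e2 : ∀ x : Σ _ : γ, γ, (Real.sqrt (ω x.1 x.2) * a x.1 x.2) ^ 2 = ω x.1 x.2 * a x.1 x.2 ^ 2 := fun x => by
    rw [mul_pow, Real.sq_sqrt (hω x.1 x.2)]
  have e3 : ∀ x : Σ _ : γ, γ, (Real.sqrt (ω x.1 x.2) * b x.1 x.2) ^ 2 = ω x.1 x.2 * b x.1 x.2 ^ 2 := fun x => by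
    rw [mul_pow, Real.sq_sqrt (hω x.1 x.2)]
  simp only [e1, e2, e3] at h
  rw [Finset.sum_sigma, Finset.sum_sigma, Finset.sum_sigma] at h
  have h0 : 0 ≤ ∑ p ∈ T, ∑ q ∈ U p, ω p q * a p q * b p q :=
    Finset.sum_nonneg fun p _ => Finset.sum_nonneg fun q _ => mul_nonneg (mul_nonneg (hω _ _) (ha _ _)) (hb _ _)
  have hA0 : 0 ≤ ∑ p ∈ T, ∑ q ∈ U p, ω p q * a p q ^ 2 := Finset.sum_nonneg fun p _ => Finset.sum_nonneg fun q _ => by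
    have := hω p q; positivity
  rw [← Real.sqrt_mul hA0, ← Real.sqrt_sq h0]
  exact Real.sqrt_le_sqrt h

/-! ## Reduction of a symmetric pair sum to the rows of the ball -/

/-- For a symmetric nonnegative pair function vanishing when both arguments are outside `B ⊆ T`:
`Σ_{p∈T} Σ_{q∈T∖p} G p q ≤ 2 Σ_{p∈B} Σ_{q∈T∖p} G p q`. [folklore] -/
theorem sum_pairs_le_two_mul_rows {γ : Type*} [DecidableEq γ] (T B : Finset γ) (hBT : B ⊆ T) (G : γ → γ → ℝ)
    (hsymm : ∀ p ∈ T, ∀ q ∈ T, G p q = G q p) (hG0 : ∀ p q, 0 ≤ G p q)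
    (hvan : ∀ p ∈ T, ∀ q ∈ T, p ∉ B → q ∉ B → G p q = 0) :
    ∑ p ∈ T, ∑ q ∈ T.erase p, G p q ≤ 2 * ∑ p ∈ B, ∑ q ∈ T.erase p, G p q := by
  -- G p q ≤ G p q · (𝟙_B p + 𝟙_B q)
  have hpt : ∀ p ∈ T, ∀ q ∈ T.erase p, G p q ≤
      G p q * (if p ∈ B then 1 else 0) + G p q * (if q ∈ B then 1 else 0) := by
    intro p hp q hq
    have hqT := (Finset.mem_erase.1 hq).2
    by_cases hpB : p ∈ B
    · rw [if_pos hpB, mul_one]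
      have : 0 ≤ G p q * (if q ∈ B then 1 else 0) := by split_ifs <;> simp [hG0 p q]
      linarith
    · by_cases hqB : q ∈ B
      · rw [if_pos hqB, if_neg hpB, mul_one, mul_zero, zero_add]
      · rw [hvan p hp q hqT hpB hqB]; simp
  have h1 : ∑ p ∈ T, ∑ q ∈ T.erase p, G p q ≤
      ∑ p ∈ T, ∑ q ∈ T.erase p, (G p q * (if p ∈ B then 1 else 0) + G p q * (if q ∈ B then 1 else 0)) :=
    Finset.sum_le_sum fun p hp => Finset.sum_le_sum fun q hq => hpt p hp q hq
  refine h1.trans ?_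
  rw [Finset.sum_congr rfl fun p _ => Finset.sum_add_distrib (s := T.erase p)
    (f := fun q => G p q * (if p ∈ B then 1 else 0)) (g := fun q => G p q * (if q ∈ B then 1 else 0)),
    Finset.sum_add_distrib]
  -- the second sum equals the first after swapping
  have hswap : ∑ p ∈ T, ∑ q ∈ T.erase p, G p q * (if q ∈ B then 1 else 0) =
      ∑ p ∈ T, ∑ q ∈ T.erase p, G p q * (if p ∈ B then 1 else 0) := by
    rw [sum_sum_erase_comm T (fun p q => G p q * (if q ∈ B then (1 : ℝ) else 0))]
    refine Finset.sum_congr rfl fun q hq => Finset.sum_congr rfl fun p hp => ?_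
    rw [hsymm p (Finset.mem_erase.1 hp).2 q hq]
  rw [hswap, ← two_mul]
  refine mul_le_mul_of_nonneg_left (le_of_eq ?_) (by norm_num)
  -- Σ_{p∈T} 𝟙_B(p) Σ_q G = Σ_{p∈B} Σ_q G
  rw [← Finset.sum_subset hBT (f := fun p => ∑ q ∈ T.erase p, G p q * (if p ∈ B then 1 else 0))]
  · refine Finset.sum_congr rfl fun p hp => Finset.sum_congr rfl fun q _ => ?_
    rw [if_pos hp, mul_one]
  · intro p _ hpB
    refine Finset.sum_eq_zero fun q _ => ?_
    rw [if_neg hpB, mul_zero]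

/-! ## The flux pairing -/

/-- **The flux pairing bound**: with `B = {p ∈ SR : dist p c₀ ≤ ρ'}` carrying the support of `w`,
`‖Φ p q‖ ≤ Λ |p−q|⁻⁸ ‖vt p − vt q‖` and `‖vt p − vt q‖ ≤ V` on `SR`, `1 ≤ L`:
`ΣΣ_{SR} ‖Φ p q‖ ‖w p − w q‖ ≤ 2Λ [ 4·10⁶ NN[vt; c₀, ρ'+10L+20]^{1/2} · nnForm(w)^{1/2} + 2 V F₈(L) Σ_{x∈SR} ‖w x‖ ]`.
[folklore] -/
theorem flux_pairing_le {w vt : (EuclideanSpace ℝ (Fin 3)) → (EuclideanSpace ℝ (Fin 3))} (hw : (Function.support w).Finite)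
    (SR : Finset (EuclideanSpace ℝ (Fin 3))) (hSRS : ∀ x ∈ SR, x ∈ Sites₀ t A)
    {c₀ : EuclideanSpace ℝ (Fin 3)} {ρ' : ℝ} (hwB : ∀ x, w x ≠ 0 → x ∈ SR ∧ dist x c₀ ≤ ρ')
    (Φ : (EuclideanSpace ℝ (Fin 3)) → (EuclideanSpace ℝ (Fin 3)) → (EuclideanSpace ℝ (Fin 3)))
    (hanti : ∀ p ∈ SR, ∀ q ∈ SR, Φ q p = -Φ p q) {Λ V L : ℝ} (hΛ : 0 ≤ Λ) (hV : 0 ≤ V) (hL : 1 ≤ L)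
    (hΦ : ∀ p ∈ SR, ∀ q ∈ SR, p ≠ q → ‖Φ p q‖ ≤ Λ * (dist p q)⁻¹ ^ 8 * ‖vt p - vt q‖)
    (hVb : ∀ p ∈ SR, ∀ q ∈ SR, ‖vt p - vt q‖ ≤ V) :
    ∑ p ∈ SR, ∑ q ∈ SR.erase p, ‖Φ p q‖ * ‖w p - w q‖ ≤
      2 * Λ * (4000000 * Real.sqrt (NN[vt, c₀, ρ' + 10 * L + 20]) * Real.sqrt (nnForm t A w) +
        2 * V * (1024 / ((23 / 25 : ℝ) ^ 3 * L ^ 5)) * ∑ x ∈ SR, ‖w x‖) := by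
  classical
  set B := SR.filter (fun p => dist p c₀ ≤ ρ') with hB
  have hBT : B ⊆ SR := Finset.filter_subset _ _
  -- (1) reduce to the rows of `B`
  have hred := sum_pairs_le_two_mul_rows SR B hBT (fun p q => ‖Φ p q‖ * ‖w p - w q‖)
    (fun p hp q hq => by
      show ‖Φ p q‖ * ‖w p - w q‖ = ‖Φ q p‖ * ‖w q - w p‖
      rw [hanti p hp q hq, norm_neg, norm_sub_rev])
    (fun p q => by positivity)
    (fun p hp q hq hpB hqB => by
      have hp0 : w p = 0 := by
        by_contra h; exact hpB (by rw [hB, Finset.mem_filter]; exact ⟨hp, (hwB p h).2⟩)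
      have hq0 : w q = 0 := by
        by_contra h; exact hqB (by rw [hB, Finset.mem_filter]; exact ⟨hq, (hwB q h).2⟩)
      simp [hp0, hq0])
  refine hred.trans ?_
  rw [mul_assoc (2 : ℝ) Λ, mul_assoc (2 : ℝ)]
  refine mul_le_mul_of_nonneg_left ?_ (by norm_num)
  -- (2) bound the rows: split each row into near and far pairs
  have hrow : ∀ p ∈ B, ∑ q ∈ SR.erase p, ‖Φ p q‖ * ‖w p - w q‖ ≤
      Λ * (∑ q ∈ (SR.erase p).filter (fun q => dist p q ≤ L), (dist p q)⁻¹ ^ 8 * ‖vt p - vt q‖ * ‖w p - w q‖) +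
      Λ * (V * (∑ q ∈ (SR.erase p).filter (fun q => ¬ dist p q ≤ L), (dist p q)⁻¹ ^ 8 * (‖w p‖ + ‖w q‖))) := by
    intro p hp
    have hpS := hBT hp
    rw [← Finset.sum_filter_add_sum_filter_not (SR.erase p) (fun q => dist p q ≤ L), Finset.mul_sum, Finset.mul_sum,
      Finset.mul_sum]
    refine add_le_add (Finset.sum_le_sum fun q hq => ?_) (Finset.sum_le_sum fun q hq => ?_)
    · obtain ⟨hq, -⟩ := Finset.mem_filter.1 hq
      obtain ⟨hne, hqS⟩ := Finset.mem_erase.1 hq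
      have := hΦ p hpS q hqS (Ne.symm hne)
      calc ‖Φ p q‖ * ‖w p - w q‖ ≤ (Λ * (dist p q)⁻¹ ^ 8 * ‖vt p - vt q‖) * ‖w p - w q‖ :=
            mul_le_mul_of_nonneg_right this (norm_nonneg _)
        _ = Λ * ((dist p q)⁻¹ ^ 8 * ‖vt p - vt q‖ * ‖w p - w q‖) := by ring
    · obtain ⟨hq, -⟩ := Finset.mem_filter.1 hq
      obtain ⟨hne, hqS⟩ := Finset.mem_erase.1 hq
      have h1 := hΦ p hpS q hqS (Ne.symm hne)
      have h2 := hVb p hpS q hqS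
      have h3 : ‖w p - w q‖ ≤ ‖w p‖ + ‖w q‖ := norm_sub_le _ _
      have h4 : 0 ≤ (dist p q)⁻¹ ^ 8 := by positivity
      calc ‖Φ p q‖ * ‖w p - w q‖ ≤ (Λ * (dist p q)⁻¹ ^ 8 * ‖vt p - vt q‖) * (‖w p‖ + ‖w q‖) :=
            mul_le_mul h1 h3 (norm_nonneg _) (by positivity)
        _ ≤ (Λ * (dist p q)⁻¹ ^ 8 * V) * (‖w p‖ + ‖w q‖) := by gcongr
        _ = Λ * (V * ((dist p q)⁻¹ ^ 8 * (‖w p‖ + ‖w q‖))) := by ring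
  refine (Finset.sum_le_sum hrow).trans ?_
  rw [Finset.sum_add_distrib, ← Finset.mul_sum, ← Finset.mul_sum, ← Finset.mul_sum, ← mul_add]
  refine mul_le_mul_of_nonneg_left (add_le_add ?_ ?_) hΛ
  · -- (3) the near pairs: Cauchy–Schwarz and the localised long-range estimate, twice
    have hCS := sum_sum_weight_mul_le B (fun p => (SR.erase p).filter (fun q => dist p q ≤ L))
      (ω := fun p q => (dist p q)⁻¹ ^ 8) (a := fun p q => ‖vt p - vt q‖) (b := fun p q => ‖w p - w q‖)
      (fun p q => by positivity) (fun p q => norm_nonneg _) (fun p q => norm_nonneg _)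
    refine hCS.trans ?_
    -- each weighted sum is bounded by the long-range lemma
    have hsub1 : B ⊆ (finite_sites_dist_le (t := t) (A := A) hA hI c₀ ρ').toFinset := by
      intro p hp
      rw [hB, Finset.mem_filter] at hp
      exact (Set.Finite.mem_toFinset _).2 ⟨hSRS p hp.1, hp.2⟩
    have hsub2 : ∀ p ∈ B, (SR.erase p).filter (fun q => dist p q ≤ L) ⊆
        (finite_sites_dist_le (t := t) (A := A) hA hI c₀ (ρ' + L)).toFinset := by
      intro p hp q hq
      rw [hB, Finset.mem_filter] at hp
      obtain ⟨hq, hqL⟩ := Finset.mem_filter.1 hq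
      refine (Set.Finite.mem_toFinset _).2 ⟨hSRS q (Finset.mem_erase.1 hq).2, ?_⟩
      have := dist_triangle q p c₀
      rw [dist_comm q p] at this
      linarith
    have hLR : ∀ (f : (EuclideanSpace ℝ (Fin 3)) → (EuclideanSpace ℝ (Fin 3))),
        ∑ p ∈ B, ∑ q ∈ (SR.erase p).filter (fun q => dist p q ≤ L), (dist p q)⁻¹ ^ 8 * ‖f p - f q‖ ^ 2 ≤
          4000000 * NN[f, c₀, ρ' + 10 * L + 20] := by
      intro f
      refine le_trans ?_ (longRange_local_le hA hI f c₀ (R := ρ') hL)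
      refine le_trans (Finset.sum_le_sum fun p hp => ?_)
        (Finset.sum_le_sum_of_subset_of_nonneg hsub1 fun p _ _ => Finset.sum_nonneg fun q _ => by positivity)
      refine le_trans (Finset.sum_le_sum fun q hq => ?_)
        (Finset.sum_le_sum_of_subset_of_nonneg (hsub2 p hp) fun q _ _ => by positivity)
      obtain ⟨hq, hqL⟩ := Finset.mem_filter.1 hq
      rw [if_pos ⟨Ne.symm (Finset.mem_erase.1 hq).1, hqL⟩]
    have h1 := hLR vt
    have h2 := (hLR w).trans (mul_le_mul_of_nonneg_left (NN_le_nnForm hA hI hw c₀ _) (by norm_num))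
    have hs1 := Real.sqrt_le_sqrt h1
    have hs2 := Real.sqrt_le_sqrt h2
    rw [Real.sqrt_mul (by norm_num), show Real.sqrt (4000000 : ℝ) = 2000 by
      rw [show (4000000 : ℝ) = 2000 ^ 2 by norm_num, Real.sqrt_sq (by norm_num)]] at hs1 hs2
    calc _ ≤ (2000 * Real.sqrt (NN[vt, c₀, ρ' + 10 * L + 20])) * (2000 * Real.sqrt (nnForm t A w)) :=
          mul_le_mul hs1 hs2 (Real.sqrt_nonneg _) (by positivity)
      _ = 4000000 * Real.sqrt (NN[vt, c₀, ρ' + 10 * L + 20]) * Real.sqrt (nnForm t A w) := by ring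
  · -- (4) the far pairs: far lattice sums
    have hL0 : 23 / 25 ≤ L := by linarith
    have hfar : ∀ p ∈ SR, ∑ q ∈ (SR.erase p).filter (fun q => ¬ dist p q ≤ L), (dist p q)⁻¹ ^ 8 ≤
        1024 / ((23 / 25 : ℝ) ^ 3 * L ^ 5) := by
      intro p hp
      obtain ⟨hs, hle⟩ := summable_far_inv_pow_eight_sites hA hI p hL0
      refine le_trans ?_ hle
      -- as a sum over sites
      have hmem : ∀ x ∈ (SR.erase p).filter (fun q => ¬ dist p q ≤ L), x ∈ Sites₀ t A := fun x hx =>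
        hSRS x (Finset.mem_erase.1 (Finset.mem_filter.1 hx).1).2
      rw [← Finset.sum_subtype_of_mem (f := fun q => (dist p q)⁻¹ ^ 8) hmem]
      refine le_trans (Finset.sum_le_sum fun q hq => ?_) (hs.sum_le_tsum _ fun q _ => by positivity)
      have hq' := (Finset.mem_subtype.1 hq)
      obtain ⟨-, hqL⟩ := Finset.mem_filter.1 hq'
      rw [if_pos (by rw [dist_comm]; exact lt_of_not_ge hqL), dist_comm]
    -- Σ_p Σ_q d⁻⁸ (‖w p‖ + ‖w q‖) ≤ F₈ Σ_p ‖w p‖ + Σ_q ‖w q‖ Σ_p d⁻⁸ ≤ 2 F₈ Σ ‖w‖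
    have hsplit : ∑ p ∈ B, ∑ q ∈ (SR.erase p).filter (fun q => ¬ dist p q ≤ L), (dist p q)⁻¹ ^ 8 * (‖w p‖ + ‖w q‖) =
        ∑ p ∈ B, ‖w p‖ * ∑ q ∈ (SR.erase p).filter (fun q => ¬ dist p q ≤ L), (dist p q)⁻¹ ^ 8 +
        ∑ p ∈ B, ∑ q ∈ (SR.erase p).filter (fun q => ¬ dist p q ≤ L), (dist p q)⁻¹ ^ 8 * ‖w q‖ := by
      rw [← Finset.sum_add_distrib]
      refine Finset.sum_congr rfl fun p _ => ?_
      rw [Finset.mul_sum, ← Finset.sum_add_distrib]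
      refine Finset.sum_congr rfl fun q _ => ?_
      ring
    rw [hsplit]
    have hA1 : ∑ p ∈ B, ‖w p‖ * ∑ q ∈ (SR.erase p).filter (fun q => ¬ dist p q ≤ L), (dist p q)⁻¹ ^ 8 ≤
        (1024 / ((23 / 25 : ℝ) ^ 3 * L ^ 5)) * ∑ x ∈ SR, ‖w x‖ := by
      calc _ ≤ ∑ p ∈ B, ‖w p‖ * (1024 / ((23 / 25 : ℝ) ^ 3 * L ^ 5)) :=
            Finset.sum_le_sum fun p hp => mul_le_mul_of_nonneg_left (hfar p (hBT hp)) (norm_nonneg _)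
        _ = (1024 / ((23 / 25 : ℝ) ^ 3 * L ^ 5)) * ∑ p ∈ B, ‖w p‖ := by rw [Finset.mul_sum]; exact Finset.sum_congr rfl fun _ _ => mul_comm _ _
        _ ≤ (1024 / ((23 / 25 : ℝ) ^ 3 * L ^ 5)) * ∑ x ∈ SR, ‖w x‖ :=
            mul_le_mul_of_nonneg_left (Finset.sum_le_sum_of_subset_of_nonneg hBT fun _ _ _ => norm_nonneg _) (by positivity)
    have hA2 : ∑ p ∈ B, ∑ q ∈ (SR.erase p).filter (fun q => ¬ dist p q ≤ L), (dist p q)⁻¹ ^ 8 * ‖w q‖ ≤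
        (1024 / ((23 / 25 : ℝ) ^ 3 * L ^ 5)) * ∑ x ∈ SR, ‖w x‖ := by
      -- enlarge to all ordered pairs of `SR`, then swap
      calc _ ≤ ∑ p ∈ SR, ∑ q ∈ SR.erase p, (if ¬ dist p q ≤ L then (dist p q)⁻¹ ^ 8 * ‖w q‖ else 0) := by
            refine le_trans (Finset.sum_le_sum fun p _ => ?_)
              (Finset.sum_le_sum_of_subset_of_nonneg hBT fun p _ _ => Finset.sum_nonneg fun q _ => by positivity)
            rw [Finset.sum_filter]
        _ = ∑ q ∈ SR, ∑ p ∈ SR.erase q, (if ¬ dist p q ≤ L then (dist p q)⁻¹ ^ 8 * ‖w q‖ else 0) :=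
            sum_sum_erase_comm SR _
        _ = ∑ q ∈ SR, ‖w q‖ * ∑ p ∈ (SR.erase q).filter (fun p => ¬ dist q p ≤ L), (dist q p)⁻¹ ^ 8 := by
            refine Finset.sum_congr rfl fun q _ => ?_
            rw [Finset.mul_sum, Finset.sum_filter]
            refine Finset.sum_congr rfl fun p _ => ?_
            rw [dist_comm p q]
            split_ifs <;> ring
        _ ≤ ∑ q ∈ SR, ‖w q‖ * (1024 / ((23 / 25 : ℝ) ^ 3 * L ^ 5)) :=
            Finset.sum_le_sum fun q hq => mul_le_mul_of_nonneg_left (hfar q hq) (norm_nonneg _)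
        _ = (1024 / ((23 / 25 : ℝ) ^ 3 * L ^ 5)) * ∑ x ∈ SR, ‖w x‖ := by
            rw [Finset.mul_sum]; exact Finset.sum_congr rfl fun _ _ => mul_comm _ _
    calc V * (∑ p ∈ B, ‖w p‖ * ∑ q ∈ (SR.erase p).filter (fun q => ¬ dist p q ≤ L), (dist p q)⁻¹ ^ 8 +
          ∑ p ∈ B, ∑ q ∈ (SR.erase p).filter (fun q => ¬ dist p q ≤ L), (dist p q)⁻¹ ^ 8 * ‖w q‖)
        ≤ V * ((1024 / ((23 / 25 : ℝ) ^ 3 * L ^ 5)) * ∑ x ∈ SR, ‖w x‖ + (1024 / ((23 / 25 : ℝ) ^ 3 * L ^ 5)) * ∑ x ∈ SR, ‖w x‖) :=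
          mul_le_mul_of_nonneg_left (add_le_add hA1 hA2) hV
      _ = 2 * (V * (1024 / ((23 / 25 : ℝ) ^ 3 * L ^ 5))) * ∑ x ∈ SR, ‖w x‖ := by ring

end

end Summit.AtomisticToContinuum.Crystallization.Theorems.ExcessDecayLiouville

end
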